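import Summits.CriticalPhenomena.PercolationContinuityZ3.Theorems.PercNearOneGluingNoHeavyLowerTailFrontierDecRowsRow44CutVertex
import Summits.CriticalPhenomena.PercolationContinuityZ3.Theorems.PercNearOneGluingNoHeavyLowerTailFrontierDecRowsRow44CrossCutCertificate
import Summits.CriticalPhenomena.PercolationContinuityZ3.Theorems.PercNearOneGluingNoHeavyLowerTailFrontierDecRowsRow44CrossCutSide
import Mathlib.Tactic.Linarith
import HarnessLib

/-!
# Frontier dec row 44 `E₃(D[ab|cy], D[a|b], D[c|y]) ≥ 0` across a CROSS cut vertex (`{a,c} | {b,y}`)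

Support file for crux `stmt-CriticalPhenomena-4575` (four-point decreasing `E₃` frontier), seat `prim-l12-p6` gen 15; memo
`run/shared/lean/prim/prim-l12/FROM-prim-l12-p6-g15-ROW44-CUT-VERTICES.md` §2.  No definitions, no named facts, no sorries.

THEOREM (`sahiE3_row44_nonneg_of_crossCut`).  Let `side : Fin n → Bool` colour the vertices, `a, c` coloured `true`, `b, y` coloured `false`,
and suppose every positive-weight edge `s(u,v)` with `u, v ≠ h` is monochromatic (so `h` is a cut vertex separating `{a,c}` from `{b,y}`, or
the two sides are not connected at all).  Then row 44 is non-negative at `(a,b,c,y)`.  With `…Row44CutVertex` (`{a,b}|{c,y}`, gen 14) and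
`…Row44ThreeOneCut` (`3|1`, this gen) every way a cut vertex can split the four terminals is covered: a vertex-minimal counterexample to
row 44 has no cut vertex.

PROOF.  Thin to the support and glue the sides at `h` (gen-14 lemmas).  Side 1 carries the three-point law of `(a,c,h)` through the
increasing events `K = {a↔c}`, `A = {a↔h}`, `G = {c↔h}`; side 2 that of `(b,y,h)` through `K' = {b↔y}`, `A' = {h↔b}`, `G' = {h↔y}`.  Then
`{a↔b} = A ∧ A'`, `{c↔y} = G ∧ G'`, and `N = ¬K ∧ ¬K' ∧ ¬(A∧G') ∧ ¬(G∧A')`; inside `¬K ∩ ¬K'` the four cross rectangles `(A∖K)×(G'∖K')`,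
`(G∖K)×(A'∖K')`, `(A∖K)×(A'∖K')`, `(G∖K)×(G'∖K')` are pairwise disjoint, so the seven probabilities of `E₃` are explicit polynomials in
`k,a,g,t = P(A∩G)` and `k',a',g',t'` (independence of the sides).  The resulting polynomial is the homogenised form `F` of
`…Row44CrossCutCertificate` at the cells `(1−a−g−k+2t, k−t, a−t, g−t, t)`, whose hypotheses are supplied by `threePoint_side_facts`
(`…Row44CrossCutSide`: cell non-negativity and nine Harris inequalities per side).  ∎
-/

noncomputable section

namespace Summit.CriticalPhenomena.PercolationContinuityZ3.Theorems.FrontierDecRows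

open MeasureTheory CovTransferCert E3GroupSepCert
open Literature.Probability.Percolation Literature.Probability.LatticeModels

variable {n : ℕ}

set_option maxHeartbeats 1600000 in
/-- The cross-cut certificate in EVENT variables: `k, a, g, t` = `P(K), P(A), P(G), P(A∩G)` on side 1 and `k₂, a₂, g₂, t₂` on
side 2, with the hypotheses in the form produced by `threePoint_side_facts`; the conclusion is Sahi's functional of row 44 written
through the four cross rectangles (as assembled in `sahiE3_row44_nonneg_of_crossCut`). [this work] -/
theorem row44_crossCut_events_nonneg (k a g t k₂ a₂ g₂ t₂ : ℝ)
    (c4 : 0 ≤ t) (c1 : t ≤ k) (c2 : t ≤ a) (c3 : t ≤ g) (c0 : a + g + k - 2 * t ≤ 1)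
    (g1 : k * a ≤ t) (g2 : k * g ≤ t) (g3 : a * g ≤ t)
    (g4 : k * (a + g - t) ≤ t) (g5 : a * (k + g - t) ≤ t) (g6 : g * (k + a - t) ≤ t)
    (g7 : (k + a - t) * (a + g - t) ≤ a) (g8 : (k + g - t) * (a + g - t) ≤ g) (g9 : (k + a - t) * (k + g - t) ≤ k)
    (d4 : 0 ≤ t₂) (d1 : t₂ ≤ k₂) (d2 : t₂ ≤ a₂) (d3 : t₂ ≤ g₂) (d0 : a₂ + g₂ + k₂ - 2 * t₂ ≤ 1)
    (k1 : k₂ * a₂ ≤ t₂) (k2' : k₂ * g₂ ≤ t₂) (k3 : a₂ * g₂ ≤ t₂)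
    (k4 : k₂ * (a₂ + g₂ - t₂) ≤ t₂) (k5 : a₂ * (k₂ + g₂ - t₂) ≤ t₂) (k6 : g₂ * (k₂ + a₂ - t₂) ≤ t₂)
    (k7 : (k₂ + a₂ - t₂) * (a₂ + g₂ - t₂) ≤ a₂) (k8 : (k₂ + g₂ - t₂) * (a₂ + g₂ - t₂) ≤ g₂)
    (k9 : (k₂ + a₂ - t₂) * (k₂ + g₂ - t₂) ≤ k₂) :
    0 ≤ 2 * ((1 - k) * (1 - k₂) - ((a - t) * (g₂ - t₂) + (g - t) * (a₂ - t₂) + (a - t) * (a₂ - t₂) + (g - t) * (g₂ - t₂)))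
        + ((1 - k) * (1 - k₂) - ((a - t) * (g₂ - t₂) + (g - t) * (a₂ - t₂))) * (1 - a * a₂) * (1 - g * g₂)
        - (((1 - k) * (1 - k₂) - ((a - t) * (g₂ - t₂) + (g - t) * (a₂ - t₂))) * (1 - a * a₂ - g * g₂ + t * t₂)
            + (1 - a * a₂) * ((1 - k) * (1 - k₂) - ((a - t) * (g₂ - t₂) + (g - t) * (a₂ - t₂) + (g - t) * (g₂ - t₂)))
            + (1 - g * g₂) * ((1 - k) * (1 - k₂) - ((a - t) * (g₂ - t₂) + (g - t) * (a₂ - t₂) + (a - t) * (a₂ - t₂)))) := by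
  have main := row44_crossCut_certificate
    (1 - a - g - k + 2 * t) (k - t) (a - t) (g - t) t (1 - a₂ - g₂ - k₂ + 2 * t₂) (k₂ - t₂) (a₂ - t₂) (g₂ - t₂) t₂
    (by linarith) (by linarith) (by linarith) (by linarith) c4 (by linarith) (by linarith) (by linarith) (by linarith) d4
    (by nlinarith [g7]) (by nlinarith [g9]) (by nlinarith [g8]) (by nlinarith [g4]) (by nlinarith [g1]) (by nlinarith [g2])
    (by nlinarith [g5]) (by nlinarith [g3]) (by nlinarith [g6])
    (by nlinarith [k7]) (by nlinarith [k9]) (by nlinarith [k8]) (by nlinarith [k4]) (by nlinarith [k1]) (by nlinarith [k2'])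
    (by nlinarith [k5]) (by nlinarith [k3]) (by nlinarith [k6])
  refine le_of_le_of_eq main ?_
  ring

set_option maxHeartbeats 1600000 in
/-- **Row 44 across an `{a,c} | {b,y}` cut vertex.**  If every positive-weight edge avoiding `h` joins two vertices of the same colour
(`side`), with `a, c` coloured `true` and `b, y` coloured `false`, then `0 ≤ E₃(D[ab|cy], D[a|b], D[c|y])` at `(a,b,c,y)` under
`prodBernoulli w` (Harris on the two three-point sides + the exact certificate `row44_crossCut_certificate`). [this work] -/
theorem sahiE3_row44_nonneg_of_crossCut (w : Sym2 (Fin n) → unitInterval) (a b c y h : Fin n) (side : Fin n → Bool)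
    (ha : side a = true) (hc : side c = true) (hb : side b = false) (hy : side y = false)
    (hw : ∀ u v : Fin n, u ≠ h → v ≠ h → side u ≠ side v → w s(u, v) = 0) :
    0 ≤ sahiE3 (prodBernoulli w) (connEvent (row 44 n (a, b, c, y)).1) (connEvent (row 44 n (a, b, c, y)).2.1)
      (connEvent (row 44 n (a, b, c, y)).2.2) := by
  classical
  have hrow : row 44 n (a, b, c, y) = (sep [a, b] [c, y], sep [a] [b], sep [c] [y]) := rfl
  simp only [hrow, connEvent_sep]
  set μ := prodBernoulli w with hμ
  set N : Set (Set (Sym2 (Fin n))) := {ω | ∀ x ∈ [a, b], ∀ z ∈ [c, y], ω ∉ openConn x z} with hN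
  set B : Set (Set (Sym2 (Fin n))) := {ω | ∀ x ∈ [a], ∀ z ∈ [b], ω ∉ openConn x z} with hB
  set C : Set (Set (Sym2 (Fin n))) := {ω | ∀ x ∈ [c], ∀ z ∈ [y], ω ∉ openConn x z} with hC
  have hab : a ≠ b := fun e => by rw [e, hb] at ha; exact Bool.false_ne_true ha
  have hay : a ≠ y := fun e => by rw [e, hy] at ha; exact Bool.false_ne_true ha
  have hcb : c ≠ b := fun e => by rw [e, hb] at hc; exact Bool.false_ne_true hc
  have hcy : c ≠ y := fun e => by rw [e, hy] at hc; exact Bool.false_ne_true hc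
  -- the two edge sets (as in `…Row44CutVertex`)
  set F₁ : Finset (Sym2 (Fin n)) := Finset.univ.filter (fun e => ∀ u ∈ e, side u = true ∨ u = h) with hF₁
  set F₂ : Finset (Sym2 (Fin n)) :=
    Finset.univ.filter (fun e => (∀ u ∈ e, side u = false ∨ u = h) ∧ ¬ ∀ u ∈ e, u = h) with hF₂
  have mem₁ : ∀ e, e ∈ F₁ ↔ ∀ u ∈ e, side u = true ∨ u = h := fun e => by rw [hF₁, Finset.mem_filter]; simp
  have mem₂ : ∀ e, e ∈ F₂ ↔ (∀ u ∈ e, side u = false ∨ u = h) ∧ ¬ ∀ u ∈ e, u = h := fun e => by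
    rw [hF₂, Finset.mem_filter]; simp
  have hdisj : Disjoint F₁ F₂ := by
    rw [Finset.disjoint_left]
    intro e h1 h2
    rw [mem₁] at h1; rw [mem₂] at h2
    apply h2.2
    intro u hu
    rcases h1 u hu with h1 | h1
    · rcases h2.1 u hu with h2 | h2
      · rw [h1] at h2; exact absurd h2 (by decide)
      · exact h2
    · exact h1
  set D : Finset (Sym2 (Fin n)) := F₁ ∪ F₂ with hD
  have hwD : ∀ e, e ∉ D → w e = 0 := by
    intro e he
    rw [hD, Finset.mem_union, not_or, mem₁, mem₂] at he
    obtain ⟨h1, h2⟩ := he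
    induction e using Sym2.ind with
    | h u v =>
      have key : u ≠ h ∧ v ≠ h ∧ side u ≠ side v := by
        by_cases hu : u = h
        · subst hu
          exfalso
          by_cases hv : v = u
          · exact h1 fun x hx => Or.inr (by rcases Sym2.mem_iff.1 hx with e | e <;> [exact e; exact e.trans hv])
          · cases hsv : side v
            · exact h2 ⟨fun x hx => by rcases Sym2.mem_iff.1 hx with e | e <;> [exact Or.inr e; exact Or.inl (e ▸ hsv)],
                fun hall => hv (hall v (Sym2.mem_iff.2 (Or.inr rfl)))⟩
            · exact h1 fun x hx => by rcases Sym2.mem_iff.1 hx with e | e <;> [exact Or.inr e; exact Or.inl (e ▸ hsv)]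
        · by_cases hv : v = h
          · subst hv
            exfalso
            cases hsu : side u
            · exact h2 ⟨fun x hx => by rcases Sym2.mem_iff.1 hx with e | e <;> [exact Or.inl (e ▸ hsu); exact Or.inr e],
                fun hall => hu (hall u (Sym2.mem_iff.2 (Or.inl rfl)))⟩
            · exact h1 fun x hx => by rcases Sym2.mem_iff.1 hx with e | e <;> [exact Or.inl (e ▸ hsu); exact Or.inr e]
          · refine ⟨hu, hv, fun hse => ?_⟩
            cases hsu : side u
            · exact h2 ⟨fun x hx => by
                  rcases Sym2.mem_iff.1 hx with e | e <;> [exact Or.inl (e ▸ hsu); exact Or.inl (e ▸ (hse ▸ hsu))],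
                fun hall => hu (hall u (Sym2.mem_iff.2 (Or.inl rfl)))⟩
            · exact h1 fun x hx => by
                rcases Sym2.mem_iff.1 hx with e | e <;> [exact Or.inl (e ▸ hsu); exact Or.inl (e ▸ (hse ▸ hsu))]
      exact hw u v key.1 key.2.1 key.2.2
  have hT : ∀ ω : Set (Sym2 (Fin n)), ∀ v u u', (openGraph (ω ∩ ↑F₁)).Adj v u → (openGraph (ω ∩ ↑F₂)).Adj v u' → v = h := by
    intro ω v u u' h1 h2
    rw [openGraph_adj] at h1 h2
    have e1 := (mem₁ _).1 (Finset.mem_coe.1 h1.1.2) v (Sym2.mem_iff.2 (Or.inl rfl))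
    have e2 := ((mem₂ _).1 (Finset.mem_coe.1 h2.1.2)).1 v (Sym2.mem_iff.2 (Or.inl rfl))
    rcases e1 with e1 | e1
    · rcases e2 with e2 | e2
      · rw [e1] at e2; exact absurd e2 (by decide)
      · exact e2
    · exact e1
  have iso₂ : ∀ ω : Set (Sym2 (Fin n)), ∀ x, side x = true → x ≠ h → ∀ u, ¬ (openGraph (ω ∩ ↑F₂)).Adj x u := by
    intro ω x hx hxh u hadj
    rw [openGraph_adj] at hadj
    rcases ((mem₂ _).1 (Finset.mem_coe.1 hadj.1.2)).1 x (Sym2.mem_iff.2 (Or.inl rfl)) with e | e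
    · rw [hx] at e; exact Bool.noConfusion e
    · exact hxh e
  have iso₁ : ∀ ω : Set (Sym2 (Fin n)), ∀ x, side x = false → x ≠ h → ∀ u, ¬ (openGraph (ω ∩ ↑F₁)).Adj x u := by
    intro ω x hx hxh u hadj
    rw [openGraph_adj] at hadj
    rcases (mem₁ _).1 (Finset.mem_coe.1 hadj.1.2) x (Sym2.mem_iff.2 (Or.inl rfl)) with e | e
    · rw [hx] at e; exact Bool.noConfusion e
    · exact hxh e
  have hsup : ∀ ω : Set (Sym2 (Fin n)), openGraph (ω ∩ ↑D) = openGraph (ω ∩ ↑F₁) ⊔ openGraph (ω ∩ ↑F₂) := by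
    intro ω
    rw [hD, Finset.coe_union, Set.inter_union_distrib_left]
    exact SimpleGraph.fromEdgeSet_union _ _
  -- reachability on the thinned configuration: same side (1 / 2) and across
  have pl : ∀ ω : Set (Sym2 (Fin n)),
      ((openGraph (ω ∩ ↑D)).Reachable a c ↔ (openGraph (ω ∩ ↑F₁)).Reachable a c) := by
    intro ω; rw [hsup ω]; exact reachable_sup_iff_left (hT ω) (iso₂ ω a ha) (iso₂ ω c hc)
  have pr : ∀ ω : Set (Sym2 (Fin n)),
      ((openGraph (ω ∩ ↑D)).Reachable b y ↔ (openGraph (ω ∩ ↑F₂)).Reachable b y) := by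
    intro ω; rw [hsup ω, sup_comm]
    exact reachable_sup_iff_left (fun v u u' h2 h1 => hT ω v u' u h1 h2) (iso₁ ω b hb) (iso₁ ω y hy)
  have pc : ∀ ω : Set (Sym2 (Fin n)), ∀ x z, side x = true → side z = false → x ≠ z →
      ((openGraph (ω ∩ ↑D)).Reachable x z ↔
        (openGraph (ω ∩ ↑F₁)).Reachable x h ∧ (openGraph (ω ∩ ↑F₂)).Reachable h z) := by
    intro ω x z hx hz hxz; rw [hsup ω]; exact reachable_sup_iff_cross (hT ω) (iso₂ ω x hx) (iso₁ ω z hz) hxz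
  -- thinned side events
  set EK : Set (Set (Sym2 (Fin n))) := {ω | ω ∩ ↑F₁ ∈ (openConn a c : Set (Set (Sym2 (Fin n))))} with hEK
  set EA : Set (Set (Sym2 (Fin n))) := {ω | ω ∩ ↑F₁ ∈ (openConn a h : Set (Set (Sym2 (Fin n))))} with hEA
  set EG : Set (Set (Sym2 (Fin n))) := {ω | ω ∩ ↑F₁ ∈ (openConn c h : Set (Set (Sym2 (Fin n))))} with hEG
  set EK' : Set (Set (Sym2 (Fin n))) := {ω | ω ∩ ↑F₂ ∈ (openConn b y : Set (Set (Sym2 (Fin n))))} with hEK'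
  set EA' : Set (Set (Sym2 (Fin n))) := {ω | ω ∩ ↑F₂ ∈ (openConn h b : Set (Set (Sym2 (Fin n))))} with hEA'
  set EG' : Set (Set (Sym2 (Fin n))) := {ω | ω ∩ ↑F₂ ∈ (openConn h y : Set (Set (Sym2 (Fin n))))} with hEG'
  -- translation of the three events
  have tB : {ω : Set (Sym2 (Fin n)) | ω ∩ ↑D ∈ B} = (EA ∩ EA')ᶜ := by
    ext ω
    simp only [hB, hEA, hEA', Set.mem_setOf_eq, List.mem_singleton, forall_eq, Set.mem_compl_iff, Set.mem_inter_iff, openConn]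
    rw [pc ω a b ha hb hab]
  have tC : {ω : Set (Sym2 (Fin n)) | ω ∩ ↑D ∈ C} = (EG ∩ EG')ᶜ := by
    ext ω
    simp only [hC, hEG, hEG', Set.mem_setOf_eq, List.mem_singleton, forall_eq, Set.mem_compl_iff, Set.mem_inter_iff, openConn]
    rw [pc ω c y hc hy hcy]
  have tN : {ω : Set (Sym2 (Fin n)) | ω ∩ ↑D ∈ N} = (EKᶜ ∩ EK'ᶜ) \ ((EA \ EK) ∩ (EG' \ EK') ∪ (EG \ EK) ∩ (EA' \ EK')) := by
    ext ω
    simp only [hN, hEK, hEA, hEG, hEK', hEA', hEG', Set.mem_setOf_eq, Set.mem_compl_iff, Set.mem_inter_iff, Set.mem_sdiff,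
      Set.mem_union, openConn, List.mem_cons, List.mem_nil_iff, or_false, forall_eq_or_imp, forall_eq]
    have hbc : (openGraph (ω ∩ ↑D)).Reachable b c ↔ (openGraph (ω ∩ ↑D)).Reachable c b := SimpleGraph.reachable_comm
    rw [pl ω, pc ω a y ha hy hay, hbc, pc ω c b hc hb hcb, pr ω]
    tauto
  have thin : ∀ X : Set (Set (Sym2 (Fin n))), μ.real X = μ.real {ω | ω ∩ ↑D ∈ X} :=
    fun X => real_eq_real_setOf_inter_mem w D hwD X
  have pre_inter : ∀ P Q : Set (Set (Sym2 (Fin n))),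
      {ω : Set (Sym2 (Fin n)) | ω ∩ ↑D ∈ P ∩ Q} = {ω | ω ∩ ↑D ∈ P} ∩ {ω | ω ∩ ↑D ∈ Q} := fun P Q => rfl
  have ms : ∀ X : Set (Set (Sym2 (Fin n))), MeasurableSet X := fun X => (Set.toFinite _).measurableSet
  -- independence of the sides
  have indep : ∀ P Q : Set (Set (Sym2 (Fin n))),
      μ.real ({ω | ω ∩ ↑F₁ ∈ P} ∩ {ω | ω ∩ ↑F₂ ∈ Q}) = μ.real {ω | ω ∩ ↑F₁ ∈ P} * μ.real {ω | ω ∩ ↑F₂ ∈ Q} := by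
    intro P Q
    refine prodBernoulli_real_inter_of_determinedBy w F₁ ?_ ?_ (ms _) (ms _)
    · rw [determinedBy_iff]; intro ω ω' hω; simp only [Set.mem_setOf_eq, hω]
    · rw [determinedBy_iff]
      intro ω ω' hω
      have hsub : (↑F₂ : Set (Sym2 (Fin n))) ⊆ (↑F₁ : Set (Sym2 (Fin n)))ᶜ := fun e he he1 =>
        Finset.disjoint_left.1 hdisj (Finset.mem_coe.1 he1) (Finset.mem_coe.1 he)
      have : ω ∩ ↑F₂ = ω' ∩ ↑F₂ := by
        rw [← Set.inter_eq_self_of_subset_right hsub, ← Set.inter_assoc, ← Set.inter_assoc, hω]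
      simp only [Set.mem_setOf_eq, this]
  -- transitivity on each side: any two of the three events imply the third
  have trK : EA ∩ EG ⊆ EK := fun ω hω => by
    simp only [hEA, hEG, hEK, Set.mem_inter_iff, Set.mem_setOf_eq, openConn] at hω ⊢; exact hω.1.trans hω.2.symm
  have trG : EA ∩ EK ⊆ EG := fun ω hω => by
    simp only [hEA, hEG, hEK, Set.mem_inter_iff, Set.mem_setOf_eq, openConn] at hω ⊢; exact hω.2.symm.trans hω.1
  have trA : EG ∩ EK ⊆ EA := fun ω hω => by
    simp only [hEA, hEG, hEK, Set.mem_inter_iff, Set.mem_setOf_eq, openConn] at hω ⊢; exact hω.2.trans hω.1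
  have trK' : EA' ∩ EG' ⊆ EK' := fun ω hω => by
    simp only [hEA', hEG', hEK', Set.mem_inter_iff, Set.mem_setOf_eq, openConn] at hω ⊢; exact hω.1.symm.trans hω.2
  have trG' : EA' ∩ EK' ⊆ EG' := fun ω hω => by
    simp only [hEA', hEG', hEK', Set.mem_inter_iff, Set.mem_setOf_eq, openConn] at hω ⊢; exact hω.1.trans hω.2
  have trA' : EG' ∩ EK' ⊆ EA' := fun ω hω => by
    simp only [hEA', hEG', hEK', Set.mem_inter_iff, Set.mem_setOf_eq, openConn] at hω ⊢; exact hω.1.trans hω.2.symm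
  -- upper sets
  have upPre₁ : ∀ u v : Fin n, IsUpperSet {ω : Set (Sym2 (Fin n)) | ω ∩ ↑F₁ ∈ (openConn u v : Set (Set (Sym2 (Fin n))))} :=
    fun u v ω ω' hle hω => isUpperSet_openConn u v (Set.inter_subset_inter_left _ hle) hω
  have upPre₂ : ∀ u v : Fin n, IsUpperSet {ω : Set (Sym2 (Fin n)) | ω ∩ ↑F₂ ∈ (openConn u v : Set (Set (Sym2 (Fin n))))} :=
    fun u v ω ω' hle hω => isUpperSet_openConn u v (Set.inter_subset_inter_left _ hle) hω
  obtain ⟨⟨c4, c1, c2, c3, c0⟩, ⟨g1, g2, g3⟩, ⟨g4, g5, g6⟩, ⟨g7, g8, g9⟩⟩ :=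
    threePoint_side_facts w (upPre₁ a c) (upPre₁ a h) (upPre₁ c h) (ms _) (ms _) (ms _) trK trG trA
  obtain ⟨⟨d4, d1, d2, d3, d0⟩, ⟨k1, k2, k3⟩, ⟨k4, k5, k6⟩, ⟨k7, k8, k9⟩⟩ :=
    threePoint_side_facts w (upPre₂ b y) (upPre₂ h b) (upPre₂ h y) (ms _) (ms _) (ms _) trK' trG' trA'
  -- atoms
  have pT : μ.real (EA ∩ EK) = μ.real (EA ∩ EG) :=
    congrArg _ (Set.Subset.antisymm (fun ω hω => ⟨hω.1, trG hω⟩) (fun ω hω => ⟨hω.1, trK hω⟩))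
  have pT2 : μ.real (EG ∩ EK) = μ.real (EA ∩ EG) :=
    congrArg _ (Set.Subset.antisymm (fun ω hω => ⟨trA hω, hω.1⟩) (fun ω hω => ⟨hω.2, trK hω⟩))
  have pT' : μ.real (EA' ∩ EK') = μ.real (EA' ∩ EG') :=
    congrArg _ (Set.Subset.antisymm (fun ω hω => ⟨hω.1, trG' hω⟩) (fun ω hω => ⟨hω.1, trK' hω⟩))
  have pT2' : μ.real (EG' ∩ EK') = μ.real (EA' ∩ EG') :=
    congrArg _ (Set.Subset.antisymm (fun ω hω => ⟨trA' hω, hω.1⟩) (fun ω hω => ⟨hω.2, trK' hω⟩))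
  have dA : μ.real (EA \ EK) = μ.real EA - μ.real (EA ∩ EG) := by
    rw [← Set.sdiff_self_inter, measureReal_sdiff Set.inter_subset_left (ms _), pT]
  have dG : μ.real (EG \ EK) = μ.real EG - μ.real (EA ∩ EG) := by
    rw [← Set.sdiff_self_inter, measureReal_sdiff Set.inter_subset_left (ms _), pT2]
  have dA' : μ.real (EA' \ EK') = μ.real EA' - μ.real (EA' ∩ EG') := by
    rw [← Set.sdiff_self_inter, measureReal_sdiff Set.inter_subset_left (ms _), pT']
  have dG' : μ.real (EG' \ EK') = μ.real EG' - μ.real (EA' ∩ EG') := by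
    rw [← Set.sdiff_self_inter, measureReal_sdiff Set.inter_subset_left (ms _), pT2']
  have cK : μ.real EKᶜ = 1 - μ.real EK := by rw [measureReal_compl (ms _)]; simp [hμ]
  have cK' : μ.real EK'ᶜ = 1 - μ.real EK' := by rw [measureReal_compl (ms _)]; simp [hμ]
  have iAA' : μ.real (EA ∩ EA') = μ.real EA * μ.real EA' := indep (openConn a h) (openConn h b)
  have iGG' : μ.real (EG ∩ EG') = μ.real EG * μ.real EG' := indep (openConn c h) (openConn h y)
  have iTT' : μ.real ((EA ∩ EG) ∩ (EA' ∩ EG')) = μ.real (EA ∩ EG) * μ.real (EA' ∩ EG') :=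
    indep (openConn a h ∩ openConn c h) (openConn h b ∩ openConn h y)
  have iKK' : μ.real (EKᶜ ∩ EK'ᶜ) = μ.real EKᶜ * μ.real EK'ᶜ := indep (openConn a c)ᶜ (openConn b y)ᶜ
  have iU₁ : μ.real ((EA \ EK) ∩ (EG' \ EK')) = μ.real (EA \ EK) * μ.real (EG' \ EK') :=
    indep (openConn a h \ openConn a c) (openConn h y \ openConn b y)
  have iU₂ : μ.real ((EG \ EK) ∩ (EA' \ EK')) = μ.real (EG \ EK) * μ.real (EA' \ EK') :=
    indep (openConn c h \ openConn a c) (openConn h b \ openConn b y)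
  have iU₃ : μ.real ((EA \ EK) ∩ (EA' \ EK')) = μ.real (EA \ EK) * μ.real (EA' \ EK') :=
    indep (openConn a h \ openConn a c) (openConn h b \ openConn b y)
  have iU₄ : μ.real ((EG \ EK) ∩ (EG' \ EK')) = μ.real (EG \ EK) * μ.real (EG' \ EK') :=
    indep (openConn c h \ openConn a c) (openConn h y \ openConn b y)
  -- the four cross rectangles inside ¬K × ¬K'
  set R : Set (Set (Sym2 (Fin n))) := EKᶜ ∩ EK'ᶜ with hR
  set U₁ : Set (Set (Sym2 (Fin n))) := (EA \ EK) ∩ (EG' \ EK') with hU₁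
  set U₂ : Set (Set (Sym2 (Fin n))) := (EG \ EK) ∩ (EA' \ EK') with hU₂
  set U₃ : Set (Set (Sym2 (Fin n))) := (EA \ EK) ∩ (EA' \ EK') with hU₃
  set U₄ : Set (Set (Sym2 (Fin n))) := (EG \ EK) ∩ (EG' \ EK') with hU₄
  have mR : μ.real R = (1 - μ.real EK) * (1 - μ.real EK') := by rw [hR, iKK', cK, cK']
  have m1 : μ.real U₁ = (μ.real EA - μ.real (EA ∩ EG)) * (μ.real EG' - μ.real (EA' ∩ EG')) := by
    rw [hU₁, iU₁, dA, dG']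
  have m2 : μ.real U₂ = (μ.real EG - μ.real (EA ∩ EG)) * (μ.real EA' - μ.real (EA' ∩ EG')) := by
    rw [hU₂, iU₂, dG, dA']
  have m3 : μ.real U₃ = (μ.real EA - μ.real (EA ∩ EG)) * (μ.real EA' - μ.real (EA' ∩ EG')) := by
    rw [hU₃, iU₃, dA, dA']
  have m4 : μ.real U₄ = (μ.real EG - μ.real (EA ∩ EG)) * (μ.real EG' - μ.real (EA' ∩ EG')) := by
    rw [hU₄, iU₄, dG, dG']
  -- pairwise disjointness (two events on one side force the third)
  have djAG : ∀ ω, ω ∈ EA \ EK → ω ∈ EG \ EK → False := fun ω h1 h2 => h1.2 (trK ⟨h1.1, h2.1⟩)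
  have djAG' : ∀ ω, ω ∈ EA' \ EK' → ω ∈ EG' \ EK' → False := fun ω h1 h2 => h1.2 (trK' ⟨h1.1, h2.1⟩)
  have d12 : Disjoint U₁ U₂ := Set.disjoint_left.2 fun ω h1 h2 => djAG ω h1.1 h2.1
  have d13 : Disjoint U₁ U₃ := Set.disjoint_left.2 fun ω h1 h2 => djAG' ω h2.2 h1.2
  have d14 : Disjoint U₁ U₄ := Set.disjoint_left.2 fun ω h1 h2 => djAG ω h1.1 h2.1
  have d23 : Disjoint U₂ U₃ := Set.disjoint_left.2 fun ω h1 h2 => djAG ω h2.1 h1.1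
  have d24 : Disjoint U₂ U₄ := Set.disjoint_left.2 fun ω h1 h2 => djAG' ω h1.2 h2.2
  have d34 : Disjoint U₃ U₄ := Set.disjoint_left.2 fun ω h1 h2 => djAG ω h1.1 h2.1
  have u12 : μ.real (U₁ ∪ U₂) = μ.real U₁ + μ.real U₂ := measureReal_union d12 (ms _)
  have u123 : μ.real (U₁ ∪ U₂ ∪ U₃) = μ.real U₁ + μ.real U₂ + μ.real U₃ := by
    rw [measureReal_union (Disjoint.union_left d13 d23) (ms _), u12]
  have u124 : μ.real (U₁ ∪ U₂ ∪ U₄) = μ.real U₁ + μ.real U₂ + μ.real U₄ := by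
    rw [measureReal_union (Disjoint.union_left d14 d24) (ms _), u12]
  have u1234 : μ.real (U₁ ∪ U₂ ∪ U₃ ∪ U₄) = μ.real U₁ + μ.real U₂ + μ.real U₃ + μ.real U₄ := by
    rw [measureReal_union (Disjoint.union_left (Disjoint.union_left d14 d24) d34) (ms _), u123]
  have sR : ∀ X : Set (Set (Sym2 (Fin n))), X ⊆ U₁ ∪ U₂ ∪ U₃ ∪ U₄ → X ⊆ R := by
    intro X hX ω hω
    rcases hX hω with ((h1 | h2) | h3) | h4
    · exact ⟨h1.1.2, h1.2.2⟩
    · exact ⟨h2.1.2, h2.2.2⟩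
    · exact ⟨h3.1.2, h3.2.2⟩
    · exact ⟨h4.1.2, h4.2.2⟩
  -- the seven probabilities
  have eB : μ.real B = 1 - μ.real EA * μ.real EA' := by
    rw [thin, tB, measureReal_compl (ms _), iAA']; simp [hμ]
  have eC : μ.real C = 1 - μ.real EG * μ.real EG' := by
    rw [thin, tC, measureReal_compl (ms _), iGG']; simp [hμ]
  have eBC : μ.real (B ∩ C) = 1 - μ.real EA * μ.real EA' - μ.real EG * μ.real EG' + μ.real (EA ∩ EG) * μ.real (EA' ∩ EG') := by
    rw [thin, pre_inter, tB, tC, ← Set.compl_union, measureReal_compl (ms _)]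
    have h1 := measureReal_union_add_inter (μ := μ) (s := EA ∩ EA') (ms (EG ∩ EG'))
    have h2 : (EA ∩ EA') ∩ (EG ∩ EG') = (EA ∩ EG) ∩ (EA' ∩ EG') := by
      ext ω; simp only [Set.mem_inter_iff]; tauto
    rw [h2, iAA', iGG', iTT'] at h1
    simp only [hμ, probReal_univ] at h1 ⊢
    linarith
  have eN : μ.real N = μ.real R - (μ.real U₁ + μ.real U₂) := by
    rw [thin, tN, ← u12]
    exact measureReal_sdiff (sR _ (fun ω hω => Or.inl (Or.inl hω))) (ms _)
  have eNB : μ.real (N ∩ B) = μ.real R - (μ.real U₁ + μ.real U₂ + μ.real U₃) := by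
    rw [thin, pre_inter, tN, tB, ← u123]
    have e : (EKᶜ ∩ EK'ᶜ) \ ((EA \ EK) ∩ (EG' \ EK') ∪ (EG \ EK) ∩ (EA' \ EK')) ∩ (EA ∩ EA')ᶜ = R \ (U₁ ∪ U₂ ∪ U₃) := by
      ext ω; simp only [hR, hU₁, hU₂, hU₃, Set.mem_sdiff, Set.mem_inter_iff, Set.mem_union, Set.mem_compl_iff]; tauto
    rw [e]; exact measureReal_sdiff (sR _ (fun ω hω => Or.inl hω)) (ms _)
  have eNC : μ.real (N ∩ C) = μ.real R - (μ.real U₁ + μ.real U₂ + μ.real U₄) := by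
    rw [thin, pre_inter, tN, tC, ← u124]
    have e : (EKᶜ ∩ EK'ᶜ) \ ((EA \ EK) ∩ (EG' \ EK') ∪ (EG \ EK) ∩ (EA' \ EK')) ∩ (EG ∩ EG')ᶜ = R \ (U₁ ∪ U₂ ∪ U₄) := by
      ext ω; simp only [hR, hU₁, hU₂, hU₄, Set.mem_sdiff, Set.mem_inter_iff, Set.mem_union, Set.mem_compl_iff]; tauto
    rw [e]
    refine measureReal_sdiff (sR _ (fun ω hω => ?_)) (ms _)
    rcases hω with (h1 | h2) | h4
    · exact Or.inl (Or.inl (Or.inl h1))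
    · exact Or.inl (Or.inl (Or.inr h2))
    · exact Or.inr h4
  have eNBC : μ.real (N ∩ B ∩ C) = μ.real R - (μ.real U₁ + μ.real U₂ + μ.real U₃ + μ.real U₄) := by
    rw [thin, pre_inter, pre_inter, tN, tB, tC, ← u1234]
    have e : (EKᶜ ∩ EK'ᶜ) \ ((EA \ EK) ∩ (EG' \ EK') ∪ (EG \ EK) ∩ (EA' \ EK')) ∩ (EA ∩ EA')ᶜ ∩ (EG ∩ EG')ᶜ =
        R \ (U₁ ∪ U₂ ∪ U₃ ∪ U₄) := by
      ext ω; simp only [hR, hU₁, hU₂, hU₃, hU₄, Set.mem_sdiff, Set.mem_inter_iff, Set.mem_union, Set.mem_compl_iff]; tauto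
    rw [e]; exact measureReal_sdiff (sR _ (fun ω hω => hω)) (ms _)
  -- the certificate (event form)
  rw [sahiE3_def, eNBC, eN, eB, eC, eBC, eNC, eNB, mR, m1, m2, m3, m4]
  exact row44_crossCut_events_nonneg _ _ _ _ _ _ _ _ c4 c1 c2 c3 c0 g1 g2 g3 g4 g5 g6 g7 g8 g9
    d4 d1 d2 d3 d0 k1 k2 k3 k4 k5 k6 k7 k8 k9

end Summit.CriticalPhenomena.PercolationContinuityZ3.Theorems.FrontierDecRows
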